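import Mathlib

/-!
# Passive dressing of a slow mode: the ODE-level energy lemma (kernel #225, lemmaR-A5 §28)

Solo-blind programme, session s89.  The corner-band energy lemma of lemmaR-A5 §28 says: a slow
amplitude `u` (bare rate `α(t)`) coupled to a damped chain mode `y` (rate `-λ(t)`) by a SKEW pair
of bonds — read-out weight `B`, injection weight `δ`, common fast factor `w(t)` — obeys the bare
bound `|u(t)| ≤ e^{∫α} |u(t')|` as soon as the chain mode out-decays the slow one (`λ ≥ -α`,
decay rate `λ` of `y` at least the decay rate `-α` of `u`),
whatever the size of the fast factor `w`.  (In the application `w = |h|P ≫ 1`, `B = B_1 = 3/2`,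
`δ = A_2(κg) > 0`, `λ + α ≥ 3K_0`; after the rotation `ỹ = iσ y` the complex Gegenbauer-bond system
becomes exactly the real skew system below; several chain modes add up termwise.)

The proof is Arnold's weighted energy `E = u² + (B/δ) y²`: the bond terms cancel and
`(e^{-2A} E)' = -e^{-2A} (2B/δ)(λ + α) y² ≤ 0` where `A' = α`.

* `passive_energy_hasDerivAt` — the exact derivative of `e^{-2A}E`;
* `passive_energy_antitone` — it is non-increasing;
* `passive_dressing_bound` — `u(t)² ≤ e^{2(A t - A t')} u(t')²` for `t' ≤ t` when `y(t') = 0`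
  (the resolvent column), i.e. dressed ≤ bare with constant one.
-/

namespace Summit.AnomalousDissipation.AnomalousDissipation.Theorems

/-- The weighted energy `e^{-2A(t)} (u(t)² + (B/δ) y(t)²)` of the skew-coupled pair. -/
noncomputable def passiveEnergy (u y A : ℝ → ℝ) (B δ : ℝ) (t : ℝ) : ℝ :=
  Real.exp (-2 * A t) * (u t * u t + B / δ * (y t * y t))

/-- EXACT DERIVATIVE.  For the skew system `u' = α u - B w y`, `y' = -λ y + δ w u` (`δ ≠ 0`) and
`A' = α`: `(e^{-2A}(u² + (B/δ)y²))' = -e^{-2A} · (2B/δ) · (λ + α) · y²` — the bond terms cancel. -/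
theorem passive_energy_hasDerivAt (u y α lam w A : ℝ → ℝ) (B δ : ℝ) (hδ : δ ≠ 0) (t : ℝ)
    (hu : HasDerivAt u (α t * u t - B * w t * y t) t)
    (hy : HasDerivAt y (-lam t * y t + δ * w t * u t) t)
    (hA : HasDerivAt A (α t) t) :
    HasDerivAt (passiveEnergy u y A B δ)
      (-(Real.exp (-2 * A t) * (2 * B / δ) * (lam t + α t) * y t ^ 2)) t := by
  unfold passiveEnergy
  have hE : HasDerivAt (fun s => Real.exp (-2 * A s)) (Real.exp (-2 * A t) * (-2 * α t)) t := by
    have h1 : HasDerivAt (fun s => -2 * A s) (-2 * α t) t := hA.const_mul (-2)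
    exact h1.exp
  have hu2 := hu.mul hu
  have hy2 := (hy.mul hy).const_mul (B / δ)
  have hall := hE.mul (hu2.add hy2)
  refine hall.congr_deriv ?_
  simp only [Pi.mul_apply, Pi.add_apply]
  field_simp
  ring

/-- PASSIVITY.  If the system holds for all `t` and the chain mode out-decays the slow one
(`-α ≤ λ`: decay rates), the weighted energy is non-increasing (`B ≥ 0`, `δ > 0`). -/
theorem passive_energy_antitone (u y α lam w A : ℝ → ℝ) (B δ : ℝ) (hB : 0 ≤ B) (hδ : 0 < δ)
    (hu : ∀ t, HasDerivAt u (α t * u t - B * w t * y t) t)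
    (hy : ∀ t, HasDerivAt y (-lam t * y t + δ * w t * u t) t)
    (hA : ∀ t, HasDerivAt A (α t) t) (hgap : ∀ t, -α t ≤ lam t) :
    Antitone (passiveEnergy u y A B δ) := by
  have hd : ∀ t, HasDerivAt (passiveEnergy u y A B δ)
      (-(Real.exp (-2 * A t) * (2 * B / δ) * (lam t + α t) * y t ^ 2)) t :=
    fun t => passive_energy_hasDerivAt u y α lam w A B δ hδ.ne' t (hu t) (hy t) (hA t)
  refine antitone_of_deriv_nonpos (fun t => (hd t).differentiableAt) fun t => ?_
  rw [(hd t).deriv]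
  have h1 : 0 ≤ Real.exp (-2 * A t) := (Real.exp_pos _).le
  have h2 : 0 ≤ 2 * B / δ := by positivity
  have h3 : 0 ≤ lam t + α t := by linarith [hgap t]
  have h4 : 0 ≤ y t ^ 2 := sq_nonneg _
  have : 0 ≤ Real.exp (-2 * A t) * (2 * B / δ) * (lam t + α t) * y t ^ 2 := by positivity
  linarith

/-- DRESSED ≤ BARE, CONSTANT ONE.  Under the same hypotheses, along the resolvent column
(`y(t') = 0`) the slow amplitude obeys `u(t)² ≤ e^{2(A(t) - A(t'))} u(t')²` for every `t ≥ t'`: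
the passively dressed slow mode decays at least as fast as the bare one, however large the fast
factor `w` — lemmaR-A5 §28, the corner band of the 2-D certificate. -/
theorem passive_dressing_bound (u y α lam w A : ℝ → ℝ) (B δ : ℝ) (hB : 0 ≤ B) (hδ : 0 < δ)
    (hu : ∀ t, HasDerivAt u (α t * u t - B * w t * y t) t)
    (hy : ∀ t, HasDerivAt y (-lam t * y t + δ * w t * u t) t)
    (hA : ∀ t, HasDerivAt A (α t) t) (hgap : ∀ t, -α t ≤ lam t)
    (t' t : ℝ) (htt : t' ≤ t) (hy0 : y t' = 0) :
    u t ^ 2 ≤ Real.exp (2 * (A t - A t')) * u t' ^ 2 := by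
  have hanti := passive_energy_antitone u y α lam w A B δ hB hδ hu hy hA hgap htt
  unfold passiveEnergy at hanti
  rw [hy0, mul_zero, mul_zero, add_zero] at hanti
  -- hanti : exp(-2 A t) * (u t * u t + B/δ * (y t * y t)) ≤ exp(-2 A t') * (u t' * u t')
  have hpos : 0 < Real.exp (-2 * A t) := Real.exp_pos _
  have hyt : 0 ≤ B / δ * (y t * y t) := by
    have := mul_self_nonneg (y t); positivity
  have h1 : Real.exp (-2 * A t) * u t ^ 2 ≤ Real.exp (-2 * A t') * u t' ^ 2 := by
    have : Real.exp (-2 * A t) * (u t * u t)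
        ≤ Real.exp (-2 * A t) * (u t * u t + B / δ * (y t * y t)) :=
      mul_le_mul_of_nonneg_left (by linarith) hpos.le
    rw [sq, sq]
    linarith
  have e0 : Real.exp (2 * A t) * (Real.exp (-2 * A t) * u t ^ 2) = u t ^ 2 := by
    rw [← mul_assoc, ← Real.exp_add]; norm_num
  have e1 : Real.exp (2 * A t) * (Real.exp (-2 * A t') * u t' ^ 2)
      = Real.exp (2 * (A t - A t')) * u t' ^ 2 := by
    rw [← mul_assoc, ← Real.exp_add]; ring_nf
  have h3 := mul_le_mul_of_nonneg_left h1 (Real.exp_pos (2 * A t)).le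
  rwa [e0, e1] at h3

end Summit.AnomalousDissipation.AnomalousDissipation.Theorems
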